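import Literature.MathematicalPhysics.QuantumFieldTheory.Balaban1983to89.BlockAveragingPlaquetteBoundLocal
import Literature.MathematicalPhysics.QuantumFieldTheory.Balaban1983to89.BlockAveragingHaarAC
import Literature.MathematicalPhysics.QuantumFieldTheory.Balaban1983to89.T4SmallFieldWindowSandwich
import Literature.MathematicalPhysics.QuantumFieldTheory.Balaban1983to89.Node00.DatumAvLayer
import HarnessLib

/-!
# DAG node N07 [B11] — Sect. F (160) CASE II ingredient AT THE FLAT BACKGROUND, FOR THE (0.4) AVERAGING OF RECORD: the CROSSING STEP of
# Lemma 1 of [6] «block average α₁-close to 1 ∧ fine plaquettes small ⇒ the transporter across the coarse bond is small», generic torus, `SU(N)`,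
# local one-step form — and its instance at `Node00.avOfRecord` after the coarse axial re-gauging of the averaged data (WIDTH-209 N07 piece 1, w5 cut)

Cell `pub-ymgap` (HUMAN RULINGS D-0062 ∕ D-0149 ∕ D-0154), width seat `pub-ymgap-dag-n07-w5` g0, 2026-08-28.  `--kind proof --supports
stmt-QuantumFields-20542 --as helper` (K1⁷; count-neutral helper on the N07 [B11] row; road-independent cut of dag-lead WIDTH-209 N07 piece 1
«Sect. F S3 residue (154)–(156)∕(160) at the record», pairing with dag-n07-e g19's module 40 `…N07DataAxialTopBox` = (147) + (160) case I).

THE PRINT.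
* [6] = T. Bałaban, *Spaces of regular gauge field configurations on a lattice and gauge fixing conditions*, Commun. Math. Phys. **99** (1985) 75–102
  `[Balaban1985RegularSpaces]`, p. 79: «**Lemma 1.** Let V₀, V′V₀ satisfy the condition (1.7) for k = 1 and L arbitrary, and let (R(V₀)V′)(Γ_{y,x}) = 1 for
  x ∈ B(y), |\overline{V′V₀} − V̄₀| < α₁ on Ω₁^{(1)}. (1.24)  Then for α₀, α₁ small the configuration V′ is also small, more precisely we have the bound
  |V′ − 1| < 4d²α₀ + α₁ on Ω₁. (1.25)»; its CROSSING STEP, p. 79 l. −3 – p. 80 l. 1: «The condition |\overline{V′V₀} − V̄₀| = |Ṽ′ − 1| < α₁ implies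
  |R(V₀([c₋, b₀,₋]))V′_{b₀} − 1| ≦ 4(d−1)(L−1)Lα₀L⁻² + α₁ < 4(d−1)α₀ + α₁», `b₀` «the unique bond of c belonging to B(c)».
* [B11] = T. Bałaban, *The variational problem and background fields in renormalization group method for lattice gauge theories*, Commun. Math. Phys.
  **102** (1985) 277–309 `[Balaban1985Variational]`, (160) p. 303, second case: «If ⟨x, x′⟩ ⊂ □̃′_k^{(k)}, then we apply the Lemma 1 of [6]. We consider
  the set Λ′ = B(x) ∪ B(x′), and the assumptions of this lemma are satisfied for V′ = V″ = V₁ with α₀ = L²ε₁, α₁ = |x − y|2L²ε₁. The lemma implies that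
  |V₁(x₁, x′₁) − 1| < 4d²L²ε₁ + |x − y|2L²ε₁ for ⟨x₁, x′₁⟩ ⊂ B(x) ∪ B(x′), hence |B(x₁, x′₁)| < 8d²L²ε₁ + |x − y|4L²ε₁.»; p. 302: «all the operators in this
  section are taken without any external gauge field configuration (or alternatively with the configuration equal to 1)» — the FLAT background `V₀ = 1`.
* [I] = T. Bałaban, *Renormalization group approach to lattice gauge field theories. I*, Commun. Math. Phys. **109** (1987) 249–301 `[Balaban1987RG1]`,
  (0.4) p. 253 — the averaging OF RECORD `Ū(c) = exp[…]·U(c)`, «valid universally for all averages satisfying (0.5)–(0.7)» (p. 253).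

WHY THIS FILE (located, dag-n07-e g18∕g19 `STUB1-SECTF-MAP.md` § LOCATED-F3 ∕ § BRIDGE-92-B).  Print proves Lemma 1 for [3]'s single-contour averaging (42)
(tree: `B8Lemma1NonAbelian.lemma1Printed_blockPairNA`, ℤᵈ carriers); the record's averaging is [I] (0.4) = the tree's `BlockAveraging.blockAvg expMeanLogSU`
(`Node00.avOfRecord`), a DIFFERENT function of `U` (LOCATED-DICT-AVG).  The crossing step of Lemma 1 is where the averaging enters; for (0.4) it holds with
the tree's constant `6t`, `t = ((d+2)L)²∕4·a`, in place of print's `4d²α₀`, because (0.4) IS «correction factor × straight transporter» (`BlockAveraging.avgFun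
= corr · axialAvg`) and the correction factor is `6t`-close to `1` under LOCAL plaquette smallness (ym3-torus-p2's `BlockAveragingPlaquetteBoundLocal.
dist1_corr_le_local`, [B7] Prop. 1 local form).  This is the (160) case-II ingredient that module 40 (dag-n07-e g19 INTENT-40) names as NOT given.

WHAT THIS FILE DOES (kernel bookkeeping over landed theorems; every estimate used is a TREE theorem cited by name; nothing of [B11] ∕ [6] beyond this
elementary step is asserted).  Generic torus `P : Params` in the standing range `j + 1 ≤ m + K`; `G = SU(N)` where the correction factor is bounded.
* §1 `axialAvg_eq_corr_inv_mul_avgFun` (`U(Γ_c) = corr⁻¹ · Ū(c)`, every small-loop average `ℰ`), `dist1_axialAvg_le_dist1_corr_add`.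
* §2 ★★ `dist1_axialAvg_le_avg_add_of_plaqSmallOn_blocks` — THE CROSSING STEP FOR (0.4): fine plaquettes based in `B(c₋ − e_μ) ∪ B(c₋) ∪ B(c₊)` within `a`
  of `1` and `t < δ_N` ⇒ `dist1 (U(Γ_c)) ≤ dist1 (Ū(c)) + 6t` (`Γ_c` = the straight centre-to-centre line of `c`, `AveragingRT.axialAvg`).
* §3 the CENTRAL crossing bond `β(c)` (print's `b₀`; tree `BlockAveragingHaarAC.centralBond`): `centralBond_eq_conj` (`U(β(c)) = pre⁻¹ · U(Γ_c) · post⁻¹`),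
  `dist1_centralBond_le_add₃`, ★ `dist1_centralBond_le_of_halfLines_eq_one` — in ANY gauge trivial along the two central half-lines (`pre U c = 1`,
  `post U c = 1`; e.g. the centre-rooted comb axial gauge at `U₀ = 1`, ym3-torus `Prop7AxialGauge.exists_axialGauge`, [6] (1.15)∕(1.19)) the bond `β(c)`
  itself is `(dist1 (Ū c) + 6t)`-close to `1` — HYPOTHESIS-FORM gauge, no gauge transformation constructed here.
* §4 ★ `dist1_openHol_le_of_plaqSmallOn_blocks` — EVERY transporter `U(Γ ∪ [x, x′] ∪ (−Γ′))` of the (0.4) family from centre to centre is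
  `(dist1 (Ū c) + 7t)`-close to `1` (gauge-covariant statement; `BlockAveragingHaarAC.loopHol_eq_openHol_mul` + `dist1_loopHol_le_local`).
* §5 AT THE RECORD (`Node00.avOfRecord F N K j`, torus family `F`, one step `j → j + 1`), in the letters of module 40: `avg_gaugeAct_blockStep`
  (`M(U^{h∘blockOf}) = (M U)^h`: covariance (11) at the block-constant one-step lift), ★★★ `dist1_axialAvg_dataAxialStep_le` — if the AVERAGED data
  `Ū := M(U)` is plaquette-small (`< δ̄`) on a non-wrapping box `[lo, hi]` of `T^{(j+1)}` with `n + 1` sites per direction and the fine plaquettes near the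
  box bonds are `< a` (guard `t < δ_N`), then for pv26's coarse axial gauge `h := axialGauge Ū lo hi` and `U′ := U^{h∘blockOf}`: every box bond `c` has
  `dist1 (U′(Γ_c)) ≤ (d − 1)·n·δ̄ + 6t` — print's «α₁ = |x − y|2L²ε₁» ↦ pv26's `(d − 1)nδ̄` (module 40's `dist1_dataAxial_le` for the averaged data), print's
  «4d²α₀» ↦ `6t`; ★★★ `exists_dataAxialStep` (one-binder form, module 40's `exists_dataAxial_topBox` shape one level down); ★★ `norm_datum_axialAvg_dataAxialStep_le`
  — for a log-like datum `β` (`‖β g‖ ≤ C·dist1 g` on `dist1 g ≤ r`; the principal logarithm has `C = 2`, `r = ½`, `B11Eq160BondField.norm_fieldB_le`):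
  `‖β(U′(Γ_c))‖ ≤ C·((d − 1)nδ̄ + 6t)` — print's «|B(x₁, x′₁)| < 8d²L²ε₁ + |x − y|4L²ε₁» shape.
* §6 NON-VACUITY (A6 hygiene): at `U = 1` every hypothesis of §5 is met (`exists_dataAxialStep_one`), the coarse smallness of `M(1)` being SUPPLIED by
  [B7] Prop. 1 local form (`plaqSmallOn_avgFun_of_near`) from the fine one (`T4SmallFieldWindowSandwich.plaqSmallOn_one`).

HONEST FRAMING (binding).  Count-neutral helper; by-name composition of landed theorems ([B7] Prop. 1 local form and the (0.4) correction-factor bound of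
cell ym3-torus, pv26's torus non-abelian Poincaré lemma, covariance (11)); the coarse plaquette smallness `δ̄` of `M(U)` is a HYPOTHESIS in §5 (suppliable by
`BlockAveragingPlaquetteBoundLocal.plaqSmallOn_avgFun_of_near`, as §6 does at `U = 1`).  NOT here (located for a successor ∕ the lane): the non-central
crossing bonds one by one and the interior bonds (a within-block ladder from `β(c)` — pv26 `dist1_gaugeAct_axialGauge_le` ∕ ym3-torus `…Prop7AxialGaugeBlock`
patterns), the far-field (155), the Landau re-gauging `u` of [6] Thm 2 and the resulting shear of the record's data ((156) stays GAP-STATED(avg-universality)),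
which road consumes the datum (the planners' word).  Near-twin NOT restated: ym3-torus `UnitScaleTiltProp7AxialLemma1` ∕ `…AxialGaugeFace` = Lemma 1 in `k`-fold
RELATIVE form at the `d = 3` carrier, `SU(2)`, global `PlaqSmall`.  Tokens ∕ stub 1 ∕ K0⁷ ∕ K1⁷ NOT closed; N07 NOT discharged (5∕27 unmoved); one finite `T⁴`
programme at fixed `ε`, Bałaban AS PRINTED — R4 closes rung `BalabanLadder.UV` only; no summit statement is proved by this seat; NOT continuum ∕ ℝ⁴ ∕ OS ∕ mass
gap ∕ Clay.  No `sorry`, no `def`, no `instance`, no `notation`.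
-/

noncomputable section

namespace Summit.QuantumFields.YangMills.BalabanUVNodes.N07Lemma1CrossingFlat

open Literature.MathematicalPhysics.QuantumFieldTheory.Balaban1983to89
open T4Continuum AveragingRT BlockAveraging ExpMeanLog
open BlockAveragingHaarAC (centralBond pre post axialAvg_eq_pre_mul_mul_post openHol loopHol_eq_openHol_mul)
open BlockAveragingPlaquetteBoundLocal (dist1_corr_le_local dist1_loopHol_le_local plaqSmallOn_avgFun_of_near)
open T4AxialGaugeSmallField (axialGauge boxPlaqs boxBonds dist1_gaugeAct_axialGauge_le_of_mem_boxBonds)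
open GaugeField (gaugeAct)

/-! ## §1  `U(Γ_c) = corr⁻¹ · Ū(c)` — the (0.4) average read backwards -/

section Algebra

variable {P : Params} {j : ℕ} {G : Type*} [GaugeGroup G]

/-- The straight centre-to-centre transporter `U(Γ_c)` (`AveragingRT.axialAvg`) is the (0.4) average divided by the correction factor:
`U(Γ_c) = corr(U, c)⁻¹ · Ū(c)` (`BlockAveraging.avgFun ℰ U c = corr ℰ U c * axialAvg U c` by definition), for every small-loop average `ℰ`.
[cite: Balaban1987RG1, (0.4) p.253] -/
theorem axialAvg_eq_corr_inv_mul_avgFun (ℰ : LoopAverage G) (U : GaugeField P j G) (c : PBond P (j + 1)) :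
    axialAvg U c = (corr ℰ U c)⁻¹ * avgFun ℰ U c := by
  show axialAvg U c = (corr ℰ U c)⁻¹ * (corr ℰ U c * axialAvg U c)
  rw [inv_mul_cancel_left]

/-- `|U(Γ_c) − 1| ≤ |corr − 1| + |Ū(c) − 1|` (`dist1` is a conjugation-invariant length: `dist1_mul_le`, `dist1_inv`).
[cite: Balaban1987RG1, (0.4) p.253] -/
theorem dist1_axialAvg_le_dist1_corr_add (ℰ : LoopAverage G) (U : GaugeField P j G) (c : PBond P (j + 1)) :
    dist1 (axialAvg U c) ≤ dist1 (corr ℰ U c) + dist1 (avgFun ℰ U c) := by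
  rw [axialAvg_eq_corr_inv_mul_avgFun ℰ U c]
  calc dist1 ((corr ℰ U c)⁻¹ * avgFun ℰ U c) ≤ dist1 (corr ℰ U c)⁻¹ + dist1 (avgFun ℰ U c) := GaugeGroup.dist1_mul_le _ _
    _ = dist1 (corr ℰ U c) + dist1 (avgFun ℰ U c) := by rw [GaugeGroup.dist1_inv]

/-- `U(β(c)) = pre⁻¹ · U(Γ_c) · post⁻¹`: the CENTRAL crossing bond `β(c)` (print's `b₀`, «the unique bond of c belonging to B(c)» on the straight line;
tree `BlockAveragingHaarAC.centralBond`) in terms of the straight transporter and the two central half-lines (`BlockAveragingHaarAC.axialAvg_eq_pre_mul_mul_post`).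
[cite: Balaban1985RegularSpaces, p.79 (proof of Lemma 1, the bond b₀)] -/
theorem centralBond_eq_conj (U : GaugeField P j G) (c : PBond P (j + 1)) :
    U (centralBond c) = (pre U c)⁻¹ * axialAvg U c * (post U c)⁻¹ := by
  rw [axialAvg_eq_pre_mul_mul_post U c]
  group

/-- `|U(β(c)) − 1| ≤ |pre − 1| + |U(Γ_c) − 1| + |post − 1|`. [cite: Balaban1985RegularSpaces, p.79 (proof of Lemma 1, the bond b₀)] -/
theorem dist1_centralBond_le_add₃ (U : GaugeField P j G) (c : PBond P (j + 1)) :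
    dist1 (U (centralBond c)) ≤ dist1 (pre U c) + dist1 (axialAvg U c) + dist1 (post U c) := by
  rw [centralBond_eq_conj U c]
  have h₁ : dist1 ((pre U c)⁻¹ * axialAvg U c * (post U c)⁻¹) ≤ dist1 ((pre U c)⁻¹ * axialAvg U c) + dist1 (post U c)⁻¹ :=
    GaugeGroup.dist1_mul_le _ _
  have h₂ : dist1 ((pre U c)⁻¹ * axialAvg U c) ≤ dist1 (pre U c)⁻¹ + dist1 (axialAvg U c) := GaugeGroup.dist1_mul_le _ _
  rw [GaugeGroup.dist1_inv] at h₁ h₂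
  linarith

/-- `|U(Γ ∪ [x,x′] ∪ (−Γ′)) − 1| ≤ |U(loop) − 1| + |U(Γ_c) − 1|` for every index of the (0.4) family: the open transporter is the loop variable times the
straight transporter (`BlockAveragingHaarAC.loopHol_eq_openHol_mul`). [cite: Balaban1987RG1, (0.4) p.253] -/
theorem dist1_openHol_le_loopHol_add (U : GaugeField P j G) (c : PBond P (j + 1)) (i : Idx P) :
    dist1 (openHol U c i) ≤ dist1 (loopHol U c i) + dist1 (axialAvg U c) := by
  have h : openHol U c i = loopHol U c i * axialAvg U c := by
    rw [loopHol_eq_openHol_mul, inv_mul_cancel_right]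
  rw [h]
  exact GaugeGroup.dist1_mul_le _ _

end Algebra

/-! ## §2  THE CROSSING STEP OF LEMMA 1 OF [6] FOR THE (0.4) AVERAGING, `SU(N)`, local form -/

section SUN

open scoped Matrix.Norms.L2Operator

variable {n : Type*} [Fintype n] [DecidableEq n] [Nonempty n] {P : Params} {j : ℕ}

/-- ★★ **LEMMA 1 OF [6], CROSSING STEP, AT THE FLAT BACKGROUND, FOR THE (0.4) AVERAGING OF RECORD** (`SU(N)`, generic torus, standing range, LOCAL
hypotheses): if every fine plaquette based in the three blocks `B(c₋ − e_μ) ∪ B(c₋) ∪ B(c₊)` is within `a ≥ 0` of `1` and `t := ((d+2)L)²∕4·a < δ_N`, then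
the straight centre-to-centre transporter across the coarse bond `c` obeys `dist1 (U(Γ_c)) ≤ dist1 (Ū(c)) + 6t`, `Ū = avgFun expMeanLogSU U` — print's
«|Ṽ′ − 1| < α₁ implies |R(V₀([c₋, b₀,₋]))V′_{b₀} − 1| ≦ 4(d−1)(L−1)Lα₀L⁻² + α₁» at `V₀ = 1`, with the tree's `6t` (`dist1_corr_le_local`) for print's `4d²α₀`.
[cite: Balaban1985RegularSpaces, Lemma 1 (1.24)-(1.25) p.79, p.80 l.1; Balaban1987RG1, (0.4) p.253] -/
theorem dist1_axialAvg_le_avg_add_of_plaqSmallOn_blocks {a : ℝ} (ha : 0 ≤ a) (hj : j + 1 ≤ P.m + P.K)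
    {U : GaugeField P j (Matrix.specialUnitaryGroup n ℂ)} (c : PBond P (j + 1))
    (hU : ∀ q : Plaq P j, (blockOf q.src = c.src.unshift c.dir ∨ blockOf q.src = c.src ∨ blockOf q.src = c.tgt) →
      dist1 (GaugeField.plaqHol U q) < a)
    (ht : ((((P.d + 2) * P.L : ℕ) : ℝ) ^ 2 / 4) * a < deltaSU n) :
    dist1 (axialAvg U c) ≤ dist1 (avgFun (expMeanLogSU (n := n)) U c) + 6 * (((((P.d + 2) * P.L : ℕ) : ℝ) ^ 2 / 4) * a) := by
  have h := dist1_axialAvg_le_dist1_corr_add (expMeanLogSU (n := n)) U c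
  have hc := dist1_corr_le_local ha hj c hU ht
  linarith

/-- ★ **THE CENTRAL CROSSING BOND `β(c)` ITSELF, hypothesis-form gauge**: under the hypotheses of `dist1_axialAvg_le_avg_add_of_plaqSmallOn_blocks`, in any
gauge in which the two central half-lines are trivial (`pre U c = 1`, `post U c = 1` — e.g. the centre-rooted comb axial gauge at the flat background, [6]
(1.15)∕(1.19)), `dist1 (U(β(c))) ≤ dist1 (Ū(c)) + 6t` — print's bond `b₀`. [cite: Balaban1985RegularSpaces, (1.15) p.78, Lemma 1 (1.25) p.79, p.80 l.1] -/
theorem dist1_centralBond_le_of_halfLines_eq_one {a : ℝ} (ha : 0 ≤ a) (hj : j + 1 ≤ P.m + P.K)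
    {U : GaugeField P j (Matrix.specialUnitaryGroup n ℂ)} (c : PBond P (j + 1))
    (hU : ∀ q : Plaq P j, (blockOf q.src = c.src.unshift c.dir ∨ blockOf q.src = c.src ∨ blockOf q.src = c.tgt) →
      dist1 (GaugeField.plaqHol U q) < a)
    (ht : ((((P.d + 2) * P.L : ℕ) : ℝ) ^ 2 / 4) * a < deltaSU n) (hpre : pre U c = 1) (hpost : post U c = 1) :
    dist1 (U (centralBond c)) ≤ dist1 (avgFun (expMeanLogSU (n := n)) U c) + 6 * (((((P.d + 2) * P.L : ℕ) : ℝ) ^ 2 / 4) * a) := by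
  have h₃ := dist1_centralBond_le_add₃ U c
  rw [hpre, hpost, GaugeGroup.dist1_one, zero_add, add_zero] at h₃
  exact h₃.trans (dist1_axialAvg_le_avg_add_of_plaqSmallOn_blocks ha hj c hU ht)

/-- The quantitative version without a gauge hypothesis: `dist1 (U(β(c))) ≤ dist1 (pre) + dist1 (post) + dist1 (Ū(c)) + 6t` — in a block-wise gauge
with within-block bonds `τ`-close to `1` the two half-lines contribute at most `(L − 1)·τ` (not expanded here).
[cite: Balaban1985RegularSpaces, Lemma 1 (1.25) p.79, p.80 l.1] -/
theorem dist1_centralBond_le_of_plaqSmallOn_blocks {a : ℝ} (ha : 0 ≤ a) (hj : j + 1 ≤ P.m + P.K)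
    {U : GaugeField P j (Matrix.specialUnitaryGroup n ℂ)} (c : PBond P (j + 1))
    (hU : ∀ q : Plaq P j, (blockOf q.src = c.src.unshift c.dir ∨ blockOf q.src = c.src ∨ blockOf q.src = c.tgt) →
      dist1 (GaugeField.plaqHol U q) < a)
    (ht : ((((P.d + 2) * P.L : ℕ) : ℝ) ^ 2 / 4) * a < deltaSU n) :
    dist1 (U (centralBond c)) ≤ dist1 (pre U c) + dist1 (post U c) +
      (dist1 (avgFun (expMeanLogSU (n := n)) U c) + 6 * (((((P.d + 2) * P.L : ℕ) : ℝ) ^ 2 / 4) * a)) := by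
  have h₃ := dist1_centralBond_le_add₃ U c
  have h := dist1_axialAvg_le_avg_add_of_plaqSmallOn_blocks ha hj c hU ht
  linarith

/-- ★ **EVERY TRANSPORTER OF THE (0.4) FAMILY IS SMALL**: under the same local hypotheses, for every index `i = (x, σ, σ′)` the open holonomy
`U(Γ ∪ [x, x′] ∪ (−Γ′))` from the centre of `B(c₋)` to the centre of `B(c₊)` obeys `dist1 ≤ dist1 (Ū(c)) + 7t` (the loop variable is `t`-small by
`dist1_loopHol_le_local`, the straight transporter `(dist1 (Ū c) + 6t)`-small by §2). [cite: Balaban1987RG1, (0.4) p.253; Balaban1985RegularSpaces, Lemma 1 (1.25) p.79] -/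
theorem dist1_openHol_le_of_plaqSmallOn_blocks {a : ℝ} (ha : 0 ≤ a) (hj : j + 1 ≤ P.m + P.K)
    {U : GaugeField P j (Matrix.specialUnitaryGroup n ℂ)} (c : PBond P (j + 1))
    (hU : ∀ q : Plaq P j, (blockOf q.src = c.src.unshift c.dir ∨ blockOf q.src = c.src ∨ blockOf q.src = c.tgt) →
      dist1 (GaugeField.plaqHol U q) < a)
    (ht : ((((P.d + 2) * P.L : ℕ) : ℝ) ^ 2 / 4) * a < deltaSU n) (i : Idx P) :
    dist1 (openHol U c i) ≤ dist1 (avgFun (expMeanLogSU (n := n)) U c) + 7 * (((((P.d + 2) * P.L : ℕ) : ℝ) ^ 2 / 4) * a) := by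
  have h₁ := dist1_openHol_le_loopHol_add U c i
  have h₂ := dist1_loopHol_le_local ha hj c hU i
  have h₃ := dist1_axialAvg_le_avg_add_of_plaqSmallOn_blocks ha hj c hU ht
  linarith

end SUN

/-! ## §5  AT THE RECORD: the averaged data in pv26's coarse axial gauge, the fine field lifted block-constantly -/

section Record

open scoped Matrix.Norms.L2Operator
open Node00 (avOfRecord avOfRecord_avg)

variable {F : T4Family} {N : ℕ} [NeZero N] {K j : ℕ}

/-- **Covariance (11) at the one-step block-constant lift**: re-gauging the fine field by `x ↦ h(blockOf x)` re-gauges the (0.4)-averaged field by `h`: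
`M(U^{h∘blockOf}) = (M U)^h` (`BlockAveraging.avgFun_covariant` + `Site.blockOf_emb`; the `k`-step form is node00-def-B's ∕ dag-n09-w3's `iter_gaugeAct_blockLift`).
[cite: Balaban1985Averaging, (11) p.19; Balaban1987RG1, (0.4) p.253] -/
theorem avg_gaugeAct_blockStep (hj : j + 1 ≤ (F.P K).m + (F.P K).K) (h : GaugeTransf (F.P K) (j + 1) (Node00.SU N))
    (U : GaugeField (F.P K) j (Node00.SU N)) :
    (avOfRecord F N K j).avg (gaugeAct (fun x => h (blockOf x)) U) = gaugeAct h ((avOfRecord F N K j).avg U) := by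
  rw [avOfRecord_avg, avgFun_covariant _ hj]
  have hfun : (fun y : Site (F.P K) (j + 1) => (fun x : Site (F.P K) j => h (blockOf x)) (emb y)) = h := by
    funext y
    simp only [Site.blockOf_emb hj y]
  rw [hfun]

/-- Plaquette smallness of the FINE field is unchanged by the lift (gauge invariance of `|U(∂p) − 1|`, `T4ReTrLipUnitary.plaqHol_gaugeAct` +
`dist1_conj`). [cite: Balaban1985Averaging, (12)-(13) p.19] -/
theorem dist1_plaqHol_gaugeAct_eq (u : GaugeTransf (F.P K) j (Node00.SU N)) (U : GaugeField (F.P K) j (Node00.SU N)) (q : Plaq (F.P K) j) :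
    dist1 (GaugeField.plaqHol (gaugeAct u U) q) = dist1 (GaugeField.plaqHol U q) := by
  rw [T4ReTrLipUnitary.plaqHol_gaugeAct]
  exact GaugeGroup.dist1_conj _ _

/-- §2 read at the averaging OF RECORD (`Node00.avOfRecord F N K j = blockAvg expMeanLogSU`, definitional): under the local hypotheses,
`dist1 (U(Γ_c)) ≤ dist1 (M(U)(c)) + 6t`. [cite: Balaban1985RegularSpaces, Lemma 1 (1.25) p.79, p.80 l.1; Balaban1987RG1, (0.4) p.253] -/
theorem dist1_axialAvg_le_avOfRecord_add {a : ℝ} (ha : 0 ≤ a) (hj : j + 1 ≤ (F.P K).m + (F.P K).K)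
    {U : GaugeField (F.P K) j (Node00.SU N)} (c : PBond (F.P K) (j + 1))
    (hU : ∀ q : Plaq (F.P K) j, (blockOf q.src = c.src.unshift c.dir ∨ blockOf q.src = c.src ∨ blockOf q.src = c.tgt) →
      dist1 (GaugeField.plaqHol U q) < a)
    (ht : (((((F.P K).d + 2) * (F.P K).L : ℕ) : ℝ) ^ 2 / 4) * a < deltaSU (Fin N)) :
    dist1 (axialAvg U c) ≤ dist1 ((avOfRecord F N K j).avg U c) + 6 * ((((((F.P K).d + 2) * (F.P K).L : ℕ) : ℝ) ^ 2 / 4) * a) := by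
  rw [avOfRecord_avg]
  exact dist1_axialAvg_le_avg_add_of_plaqSmallOn_blocks ha hj c hU ht

/-- ★★★ **[B11] (147) + (160) CASE II AT THE RECORD, STRAIGHT-TRANSPORTER FORM.**  Fine field `U` on `T^{(j)}` of the torus `F.P K`, averaged data
`Ū := M(U)` (`Node00.avOfRecord`, (0.4)); a non-wrapping box `[lo, hi]` of `T^{(j+1)}` with `n + 1` sites per direction (`n < sitesPerDir (j+1)`) on whose
plaquettes `Ū` is `δ̄`-small (`S₀ ⊇ boxPlaqs lo hi`, `0 ≤ δ̄`); fine plaquettes based in the blocks around every box bond `a`-small, guard `t < δ_N`.  Then with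
pv26's COARSE axial gauge `h := axialGauge Ū lo hi` and the block-constantly lifted fine field `U′ := U^{h∘blockOf}`: the averaged data of `U′` IS `Ū^h`, and
across every box bond `c` the straight fine transporter obeys `dist1 (U′(Γ_c)) ≤ (d − 1)·n·δ̄ + 6t` — print's «α₁ = |x − y|2L²ε₁» (the coarse axial-gauge
bound, pv26 `dist1_gaugeAct_axialGauge_le_of_mem_boxBonds`, = module 40's `dist1_dataAxial_le` for the averaged data) plus the tree's `6t` for print's «4d²α₀».
[cite: Balaban1985Variational, (147) p.301, (160) p.303; Balaban1985RegularSpaces, Lemma 1 (1.25) p.79] -/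
theorem dist1_axialAvg_dataAxialStep_le (hj : j + 1 ≤ (F.P K).m + (F.P K).K) (U : GaugeField (F.P K) j (Node00.SU N))
    {lo hi : Fin (F.P K).d → ℤ} {δ a : ℝ} {S₀ : Set (Plaq (F.P K) (j + 1))} {n : ℕ}
    (hS₀ : boxPlaqs lo hi ⊆ S₀) (hbar : PlaqSmallOn S₀ δ ((avOfRecord F N K j).avg U)) (hδ : 0 ≤ δ)
    (hn : ∀ κ, hi κ ≤ lo κ + n) (hnN : n < (F.P K).sitesPerDir (j + 1)) (ha : 0 ≤ a)
    (hU : ∀ c ∈ boxBonds lo hi, ∀ q : Plaq (F.P K) j,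
      (blockOf q.src = c.src.unshift c.dir ∨ blockOf q.src = c.src ∨ blockOf q.src = c.tgt) → dist1 (GaugeField.plaqHol U q) < a)
    (ht : (((((F.P K).d + 2) * (F.P K).L : ℕ) : ℝ) ^ 2 / 4) * a < deltaSU (Fin N))
    {c : PBond (F.P K) (j + 1)} (hc : c ∈ boxBonds lo hi) :
    dist1 (axialAvg (gaugeAct (fun x => axialGauge ((avOfRecord F N K j).avg U) lo hi (blockOf x)) U) c) ≤
      (((F.P K).d - 1 : ℕ) : ℝ) * n * δ + 6 * ((((((F.P K).d + 2) * (F.P K).L : ℕ) : ℝ) ^ 2 / 4) * a) := by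
  -- the fine plaquettes of `U′ := U^{h∘blockOf}` are those of `U` up to conjugation
  have hU'plaq : ∀ q : Plaq (F.P K) j,
      (blockOf q.src = c.src.unshift c.dir ∨ blockOf q.src = c.src ∨ blockOf q.src = c.tgt) →
        dist1 (GaugeField.plaqHol (gaugeAct (fun x => axialGauge ((avOfRecord F N K j).avg U) lo hi (blockOf x)) U) q) < a := by
    intro q hq
    rw [dist1_plaqHol_gaugeAct_eq]
    exact hU c hc q hq
  -- §2 for `U′`, read at the averaging of record
  have h₂ := dist1_axialAvg_le_avOfRecord_add (F := F) (N := N) (K := K) ha hj c hU'plaq ht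
  -- the averaged data of `U′` is `Ū^h` (covariance at the block-constant lift) …
  have havg := congrFun (avg_gaugeAct_blockStep hj (axialGauge ((avOfRecord F N K j).avg U) lo hi) U) c
  -- … whose box bonds are `(d−1)nδ̄`-small (pv26's torus Poincaré lemma for the averaged data)
  have h₅ : dist1 (gaugeAct (axialGauge ((avOfRecord F N K j).avg U) lo hi) ((avOfRecord F N K j).avg U) c) ≤
      (((F.P K).d - 1 : ℕ) : ℝ) * n * δ :=
    dist1_gaugeAct_axialGauge_le_of_mem_boxBonds _ hS₀ hbar hδ hn hnN hc
  rw [havg] at h₂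
  linarith

/-- ★★★ **THE ONE-BINDER PACKAGE (module 40's `exists_dataAxial_topBox` shape, one level down, with the FINE companion)**: under the hypotheses of
`dist1_axialAvg_dataAxialStep_le` there is a coarse gauge transformation `h` of `T^{(j+1)}` such that (i) the averaged data of the lifted fine field
`U^{h∘blockOf}` is `M(U)^h`, (ii) every box bond of `M(U)^h` has `dist1 ≤ (d − 1)·n·δ̄` ((147) + (160) case I for the averaged data), and (iii) every
straight fine transporter of `U^{h∘blockOf}` across a box bond has `dist1 ≤ (d − 1)·n·δ̄ + 6t` ((160) case II, crossing step).
[cite: Balaban1985Variational, (147) p.301, (160) p.303; Balaban1985RegularSpaces, Lemma 1 (1.25) p.79] -/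
theorem exists_dataAxialStep (hj : j + 1 ≤ (F.P K).m + (F.P K).K) (U : GaugeField (F.P K) j (Node00.SU N))
    {lo hi : Fin (F.P K).d → ℤ} {δ a : ℝ} {S₀ : Set (Plaq (F.P K) (j + 1))} {n : ℕ}
    (hS₀ : boxPlaqs lo hi ⊆ S₀) (hbar : PlaqSmallOn S₀ δ ((avOfRecord F N K j).avg U)) (hδ : 0 ≤ δ)
    (hn : ∀ κ, hi κ ≤ lo κ + n) (hnN : n < (F.P K).sitesPerDir (j + 1)) (ha : 0 ≤ a)
    (hU : ∀ c ∈ boxBonds lo hi, ∀ q : Plaq (F.P K) j,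
      (blockOf q.src = c.src.unshift c.dir ∨ blockOf q.src = c.src ∨ blockOf q.src = c.tgt) → dist1 (GaugeField.plaqHol U q) < a)
    (ht : (((((F.P K).d + 2) * (F.P K).L : ℕ) : ℝ) ^ 2 / 4) * a < deltaSU (Fin N)) :
    ∃ h : GaugeTransf (F.P K) (j + 1) (Node00.SU N),
      (avOfRecord F N K j).avg (gaugeAct (fun x => h (blockOf x)) U) = gaugeAct h ((avOfRecord F N K j).avg U) ∧
      (∀ c ∈ boxBonds lo hi, dist1 (gaugeAct h ((avOfRecord F N K j).avg U) c) ≤ (((F.P K).d - 1 : ℕ) : ℝ) * n * δ) ∧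
      ∀ c ∈ boxBonds lo hi, dist1 (axialAvg (gaugeAct (fun x => h (blockOf x)) U) c) ≤
        (((F.P K).d - 1 : ℕ) : ℝ) * n * δ + 6 * ((((((F.P K).d + 2) * (F.P K).L : ℕ) : ℝ) ^ 2 / 4) * a) :=
  ⟨axialGauge ((avOfRecord F N K j).avg U) lo hi, avg_gaugeAct_blockStep hj _ U,
    fun _ hc => dist1_gaugeAct_axialGauge_le_of_mem_boxBonds _ hS₀ hbar hδ hn hnN hc,
    fun _ hc => dist1_axialAvg_dataAxialStep_le hj U hS₀ hbar hδ hn hnN ha hU ht hc⟩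

/-- ★★ **(160) CASE II, LOG-DATUM SHAPE** (module 40 §3's letters): for a log-like `β : SU(N) → E` with `‖β g‖ ≤ C·dist1 g` whenever `dist1 g ≤ r`
(the principal logarithm `(1∕i) log`: `C = 2`, `r = ½`, `B11Eq160BondField.norm_fieldB_le`), and `(d − 1)nδ̄ + 6t ≤ r`, the datum of the straight fine
transporter across every box bond obeys `‖β(U′(Γ_c))‖ ≤ C·((d − 1)nδ̄ + 6t)` — print's «hence |B(x₁, x′₁)| < 8d²L²ε₁ + |x − y|4L²ε₁».
[cite: Balaban1985Variational, (160) p.303] -/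
theorem norm_datum_axialAvg_dataAxialStep_le {E : Type*} [SeminormedAddCommGroup E] (β : Node00.SU N → E) {C r : ℝ} (hC : 0 ≤ C)
    (hβ : ∀ g : Node00.SU N, dist1 g ≤ r → ‖β g‖ ≤ C * dist1 g)
    (hj : j + 1 ≤ (F.P K).m + (F.P K).K) (U : GaugeField (F.P K) j (Node00.SU N))
    {lo hi : Fin (F.P K).d → ℤ} {δ a : ℝ} {S₀ : Set (Plaq (F.P K) (j + 1))} {n : ℕ}
    (hS₀ : boxPlaqs lo hi ⊆ S₀) (hbar : PlaqSmallOn S₀ δ ((avOfRecord F N K j).avg U)) (hδ : 0 ≤ δ)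
    (hn : ∀ κ, hi κ ≤ lo κ + n) (hnN : n < (F.P K).sitesPerDir (j + 1)) (ha : 0 ≤ a)
    (hU : ∀ c ∈ boxBonds lo hi, ∀ q : Plaq (F.P K) j,
      (blockOf q.src = c.src.unshift c.dir ∨ blockOf q.src = c.src ∨ blockOf q.src = c.tgt) → dist1 (GaugeField.plaqHol U q) < a)
    (ht : (((((F.P K).d + 2) * (F.P K).L : ℕ) : ℝ) ^ 2 / 4) * a < deltaSU (Fin N))
    (hr : (((F.P K).d - 1 : ℕ) : ℝ) * n * δ + 6 * ((((((F.P K).d + 2) * (F.P K).L : ℕ) : ℝ) ^ 2 / 4) * a) ≤ r)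
    {c : PBond (F.P K) (j + 1)} (hc : c ∈ boxBonds lo hi) :
    ‖β (axialAvg (gaugeAct (fun x => axialGauge ((avOfRecord F N K j).avg U) lo hi (blockOf x)) U) c)‖ ≤
      C * ((((F.P K).d - 1 : ℕ) : ℝ) * n * δ + 6 * ((((((F.P K).d + 2) * (F.P K).L : ℕ) : ℝ) ^ 2 / 4) * a)) := by
  have hd := dist1_axialAvg_dataAxialStep_le hj U hS₀ hbar hδ hn hnN ha hU ht hc
  exact (hβ _ (hd.trans hr)).trans (mul_le_mul_of_nonneg_left hd hC)

/-! ## §6  Non-vacuity (A6 hygiene): the unit configuration meets every hypothesis -/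

/-- NON-VACUITY of §5: at `U = 1`, `a > 0` with `t < δ_N`, and `δ̄ := (L² + 6((d+2)L)²)·a`, every hypothesis of `exists_dataAxialStep` is met on any
non-wrapping box — the fine plaquettes of `1` are trivially small (`T4SmallFieldWindowSandwich.plaqSmallOn_one`) and the coarse smallness of `M(1)` on the
box is SUPPLIED by [B7] Prop. 1 in local form (`BlockAveragingPlaquetteBoundLocal.plaqSmallOn_avgFun_of_near`) — so the conclusion is inhabited.
[cite: Balaban1985Averaging, Prop. 1 (51) p.26; Balaban1985Variational, (147) p.301 (bookkeeping)] -/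
theorem exists_dataAxialStep_one (hj : j + 1 ≤ (F.P K).m + (F.P K).K) {lo hi : Fin (F.P K).d → ℤ} {a : ℝ} {n : ℕ} (ha : 0 < a)
    (hn : ∀ κ, hi κ ≤ lo κ + n) (hnN : n < (F.P K).sitesPerDir (j + 1))
    (ht : (((((F.P K).d + 2) * (F.P K).L : ℕ) : ℝ) ^ 2 / 4) * a < deltaSU (Fin N)) :
    ∃ h : GaugeTransf (F.P K) (j + 1) (Node00.SU N),
      (avOfRecord F N K j).avg (gaugeAct (fun x => h (blockOf x)) (1 : GaugeField (F.P K) j (Node00.SU N))) =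
          gaugeAct h ((avOfRecord F N K j).avg 1) ∧
      (∀ c ∈ boxBonds lo hi, dist1 (gaugeAct h ((avOfRecord F N K j).avg (1 : GaugeField (F.P K) j (Node00.SU N))) c) ≤
        (((F.P K).d - 1 : ℕ) : ℝ) * n * ((((F.P K).L : ℝ) ^ 2 + 6 * ((((F.P K).d + 2) * (F.P K).L : ℕ) : ℝ) ^ 2) * a)) ∧
      ∀ c ∈ boxBonds lo hi, dist1 (axialAvg (gaugeAct (fun x => h (blockOf x)) (1 : GaugeField (F.P K) j (Node00.SU N))) c) ≤
        (((F.P K).d - 1 : ℕ) : ℝ) * n * ((((F.P K).L : ℝ) ^ 2 + 6 * ((((F.P K).d + 2) * (F.P K).L : ℕ) : ℝ) ^ 2) * a) +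
          6 * ((((((F.P K).d + 2) * (F.P K).L : ℕ) : ℝ) ^ 2 / 4) * a) := by
  have hfine : ∀ (S : Set (Plaq (F.P K) j)), PlaqSmallOn S a (1 : GaugeField (F.P K) j (Node00.SU N)) :=
    fun S => T4SmallFieldWindowSandwich.plaqSmallOn_one S ha
  have hbar : PlaqSmallOn (boxPlaqs lo hi) ((((F.P K).L : ℝ) ^ 2 + 6 * ((((F.P K).d + 2) * (F.P K).L : ℕ) : ℝ) ^ 2) * a)
      ((avOfRecord F N K j).avg (1 : GaugeField (F.P K) j (Node00.SU N))) := by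
    rw [Node00.avOfRecord_apply]
    exact plaqSmallOn_avgFun_of_near hj ha.le (boxPlaqs lo hi) (hfine _) ht
  have hδ : 0 ≤ (((F.P K).L : ℝ) ^ 2 + 6 * ((((F.P K).d + 2) * (F.P K).L : ℕ) : ℝ) ^ 2) * a := by positivity
  exact exists_dataAxialStep hj 1 subset_rfl hbar hδ hn hnN ha.le
    (fun c _ q _ => hfine Set.univ q (Set.mem_univ q)) ht

end Record

end Summit.QuantumFields.YangMills.BalabanUVNodes.N07Lemma1CrossingFlat

end
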